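import Mathlib
import HarnessLib
import HarnessLib.Audit
import Summits.FinalStateConjecture.Statement
import Literature.Geometry.Lorentzian.KerrData
import Literature.Geometry.Lorentzian.TameGenericityDiagonal
import HarnessLib.Audit.Status.Attr

/-!
Route: ExactKerrEnds

# Route ExactKerrEnds — decide the conjecture along tame curves of KERR-ENDED data — Corvino–Schoen
density makes Kerr-endedness tame-generic; censorship and settling are produced along curves and
composed

It suffices to show X = E ∧ C₁ ∧ C₂ (∧ the shared anti-vacuity item M), a TYPED SPLIT of the
Statement S along the seam
"far field / bulk" with the patching lemma PROVED (lens decomposition-first; no card realised). Call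
an initial data set
KERR-ENDED if outside a compact set it is an exact spacelike leaf of a Kerr chart: a smooth open
embedding φ of an open
U ⊆ ℝ³ covering the complement of a compact K, an injective spacelike immersion ψ : U → Kerr.region
a r₀ (ingoing Kerr–Schild
chart, 0 ≤ M, any a, future unit normal ν) with φ^*h = ψ^*g_(M,a) and φ^*k = K_ν(ψ) off K (let-bound
verbatim in every item).
E (TameEscapeToKerrEnds): Kerr-endedness is TAME-Christodoulou-generic in admissibleVacuumData X —
through every admissible
non-Kerr-ended datum passes a tame, injective, immersed admissible curve whose members off 0 are
Kerr-ended (Corvino–Schoen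
density run as a tame curve: the gluing radius recedes, the glued mass converges, the weighted
C²₋₁×C¹₋₂ distance → 0).
C₁ (CensorshipAlongKerrEnds): along every tame curve of admissible data whose members off 0 are
Kerr-ended (immersed-injective,
or constant) there is a tame injective immersed admissible curve through the same base datum whose
members off 0 are Kerr-ended
AND censored (every MGHD has complete 𝓘⁺). C₂ (SettlingAlongCensoredKerrEnds): along every such
curve of censored Kerr-ended
data there is one whose members off 0 carry the full settling clause of S. M (MGHDExists, shared):
Choquet-Bruhat–Geroch.
Lean: `TameEscapeToKerrEnds ∧ CensorshipAlongKerrEnds ∧ SettlingAlongCensoredKerrEnds ∧ MGHDExists`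
(rev 5: E is DERIVED in the deciding theorem as G ∧ #6 ∧ #7 — G = TameEscapeGivenMassTheorems :=
AdmissibleMassNonneg →
ZeroMassAdmissibleMinkowskian → TameEscapeToKerrEnds, the sorry-free deliverable of E's line, and
the two promoted positive-mass
cruxes; X is unchanged.)

## Assembly
`closes (hG : TameEscapeGivenMassTheorems) (hP : AdmissibleMassNonneg) (hZ :
ZeroMassAdmissibleMinkowskian)
(hC : CensorshipAlongKerrEnds) (hS : SettlingAlongCensoredKerrEnds) (hM : MGHDExists) :
FinalStateConjecture` is PROVED in glue.lean
(rev 5, route-repair 2026-08-17; planner Sketch.lean/Sketch2.lean lean check rc 0, 0 sorries): first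
`hE : TameEscapeToKerrEnds := hG hP hZ`
(the crux E is derived from its line's deliverable G and the two promoted mass theorems — E's
nonpositive-mass branch IS #6 ∧ #7:
M ≤ 0 ⇒ M = 0 ⇒ a Minkowskian Cauchy development ⇒ Kerr-ended, landed
hasExactKerrEnd_of_cauchyDevelopment_eq_minkowski), then the
E-level assembly of rev 1–4 verbatim: fix X; every admissible datum has a sole strongly
asymptotically flat end (from the definition
of admissibleVacuumData, so constant curves are tame); (1) hE is `IsTameChristodoulouGeneric 𝓓
KerrEnded 1` and hC is precisely the
relative hypothesis of Literature `InitialDataSet.isTameChristodoulouGeneric_of_relative'` with Q =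
KerrEnded, P = KerrEnded ∧ Censored,
giving tame genericity of KerrEnded ∧ Censored; (2) the same lemma with Q = KerrEnded ∧ Censored, P
= the settling clause (hS) gives
tame genericity of the ∀-MGHD clause of the Statement; (3) `IsTameChristodoulouGeneric.mono` with hM
re-inserts the anti-vacuity
conjunct pointwise. The non-closure of genericity under ∧ is what forces the relative form: the seam
is a proved patching lemma, not
an ∧-introduction. The Assembly item is restated 1:1 to the type of `closes`
(Theorems/ExactKerrEndsAssembly.assembly_proof proves it
verbatim by positional application of `closes`). Not hypotheses of `closes`: the crux
TameEscapeToKerrEnds itself (derived; it stays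
the staffed crux, claimable directly, its line lands G) and the support item ExactKerrFarDevelopment
(first lemma of the dynamics).

Rationale: WHY THIS LINE. Mechanism = FAR-FIELD RIGIDIFICATION: the Statement's quantifier
`IsTameChristodoulouGeneric 𝓓 P 1` never asks about the
development of the exceptional datum itself, only for good data along a tame curve through it, and
tame curves may carry
receding modifications that are small in the Dafermos–Rodnianski weighted norm (recorded by the
disprover of WeakCosmicCensorshipTame,
Negative/TameMassContinuity §4: mass must converge, burial is excluded, receding o-small changes are
not); Corvino–Schoen gluing
(CorvinoSchoen2006 Thm 1 + Thm 4 = Thm 5, Corvino2000, ChruscielDelay2003; characteristic route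
AretakisCzimekRodnianski2023KerrGluing,
CzimekRodnianski2022, MaoOhTao2023) is exactly such a modification, so "Kerr-ended" is a
tame-DENSE-by-curves class, i.e. E. Because
tame genericity is not closed under ∧ (genericity_not_and_closed, Negative lemma of TameCensorship)
the two physical halves are posed
RELATIVE to curves and glued by the composition of tame genericities along curves (Literature
TameGenericityDiagonal
`isTameChristodoulouGeneric_of_relative'`, proved), twice, plus monotonicity for M — that is the
deciding theorem `closes` (28 lines,
lean rc 0). What the reduction buys for C₁/C₂ (why the hard half is MORE attackable here than in S):
every member analysed dynamically
has an EXACTLY KERR far field — its MGHD contains an exact Kerr region around i⁰ (support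
ExactKerrFarDevelopment; domain of dependence,
HawkingEllis1973CUP §7.6), so (i) the far-field FOCUSING obstruction that refutes every POINTWISE
C²-settling lemma over admissibleVacuumData
(Negative/FarFieldFocusing of StationaryLimitReduction: admissibility controls (2,1) weighted
derivatives, the conclusion is C², incoming
packets gain one) is void, (ii) hyperboloidal / r^p energy methods start from a hyperboloid that is
an exact Kerr hyperboloid outside a
compact set with finite fluxes and no Klainerman–Nicolò exterior region (KlainermanNicolo2003,
DafermosRodnianski2010ICMP, Moschidis2016,
DafermosHolzegelRodnianskiTaylor2021, KlainermanSzeftel2023), (iii) ADM and early Bondi charges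
coincide with the Kerr parameters of the
end (exact budgets for census/flux routes), (iv) 𝓘⁺ is as regular as Kerr's for early retarded time
(no initial-data log tails), and
(v) C₁ is weak cosmic censorship in the vacuum analogue of Christodoulou's fixed-asymptotics space 𝓐
(Christodoulou1999, Christodoulou1999instability:
lines α₀ + c f with f compactly supported). Imported area: initial-data gluing / elliptic theory of
the constraint map (differential
geometry of the constraint manifold, Chruściel–Delay Banach-manifold structure) used as a REDUCTION
of the summit, not as a probe.
No prior route reduces the data class: Corvino–Schoen appears in RobustClausewiseGenericity /
TameStrataCurveSelection / ProbeNullTrace /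
CurvatureOrSymmetry / LaminatedThreshold only to build compactly supported probes, and the retired
SwallowTheDatum / KerrBurial used exact
Kerr ends to HIDE the datum (excluded by T2); the negatives index (UniformPhotonSphereChannels) is
unrelated.

RANKED CRUXES. #2 SettlingAlongCensoredKerrEnds (crux) — SETTLING ALONG CENSORED KERR-ENDED CURVES.
For every X, every end e and every tame curve F of admissible data on e which is either immersed at
0 and injective or constant, and whose members off 0 are Kerr-ended and censored (every MGHD has
complete 𝓘⁺), there are an end e' and a tame, injective, immersed curve F' of admissible data on e'
with F' 0 = F 0 whose members off 0 satisfy the settling clause of the Statement for EVERY maximal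
development: complete 𝓘⁺ and an N-Kerr FinalStateDecomposition in C² of O = exteriorOf with
sub-extremal holes, RaysStayInClosure, HasExhaustiveCharts (honest radii) and IsFutureOriented. The
base datum F 0 is arbitrary (approached by Kerr-ended data as the end recedes) but is never itself
evolved. Carries the difficulty of the route (the large-data settling problem for compactly
supported deviations from exact Kerr ends, uniformly along tame curves); first lemma = support
ExactKerrFarDevelopment. [difficulty: open-problem] (why it might fail: Settling half of FSC in the
Kerr-ended class: an open set of censored Kerr-ended data with a non-Kerr ω-limit, eternal binaries,
tame-stable extremal remnants, or failure of clause C (rays off closure O) on some X refutes it;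
uniformity as R(c)→∞ may fail.) [DafermosLuk2017, KlainermanSzeftel2023,
DafermosHolzegelRodnianskiTaylor2021, CorvinoSchoen2006, DafermosRodnianski2010ICMP, Moschidis2016,
AngelopoulosKehleUnger2026]
#3 CensorshipAlongKerrEnds (crux) — CENSORSHIP ALONG KERR-ENDED CURVES (weak cosmic censorship in
positive tame codimension inside the Kerr-ended class, relative form). For every X, end e and tame
curve F of admissible data on e, immersed-injective or constant, whose members off 0 are Kerr-ended,
there are e' and a tame, injective, immersed curve F' of admissible data with F' 0 = F 0 whose
members off 0 are Kerr-ended AND censored (every maximal vacuum Cauchy development has complete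
future null infinity in the sojourn form). In the constant case the base datum is Kerr-ended and
this is Christodoulou's positive-codimension censorship for compactly supported deviations from an
exact Kerr end (his fixed space 𝓐); in the curve case it asks the censored escape to be chosen
uniformly as the Kerr end recedes towards an arbitrary admissible datum. [difficulty: open-problem]
(why it might fail: A smooth Kerr-ended vacuum datum forming a naked singularity STABLY under tame
Kerr-ended perturbations kills it (RSR examples are C^N, expected non-generic; instability proved
only for the spherical scalar field in BV); or loss of uniformity of the transversal direction as
R(c)→∞.) [Christodoulou1999, Christodoulou1999instability, RodnianskiShlapentokhRothman2023,
CorvinoSchoen2006, DafermosLuk2017]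
#4 TameEscapeToKerrEnds (crux) — KERR-ENDEDNESS IS TAME-GENERIC (Corvino–Schoen density by tame
curves). For every X, the set of admissible data that are NOT Kerr-ended has tame codimension ≥ 1 in
admissibleVacuumData X: through every such datum d passes a one-parameter family F of admissible
data, tame on one fixed end (jointly smooth, DR rates with continuous mass,
weighted-C²₋₁×C¹₋₂-continuous at 0), injective, immersed at 0, F 0 = d, whose members off 0 are
Kerr-ended. Intended witness: F c = (breathing gauge σ(c))^* of the Corvino–Schoen gluing of d to a
Kerr slice beyond radius R(c) → ∞ (CorvinoSchoen2006 Thm 1 + Thm 4; mass m(c) → M_ADM(d); P_ADM = 0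
in the DR class so the end is an unboosted, quasi-isotropic Boyer–Lindquist-type leaf, which IS
DR-admissible — KerrShieldedDataExist/Negative: bent BL ends have h − (1+2M/ρ)δ = O(ρ⁻²), k =
O(aMρ⁻³)). [difficulty: L] (why it might fail: Corvino–Schoen's degree argument gives no smooth
dependence of the Kerr parameters on the gluing radius (joint smoothness in c needs an IFT form,
Chruściel–Delay); Thm 1's harmonic-asymptotics correction must be o(1) in DR weights for wDist→0;
M_ADM=0 needs the rigidity branch.) [CorvinoSchoen2006, Corvino2000, ChruscielDelay2003,
AretakisCzimekRodnianski2023KerrGluing, CzimekRodnianski2022, MaoOhTao2023, arXiv08110354]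
#5 MGHDExists (crux) — every admissible datum has a maximal globally hyperbolic vacuum development
over the repaired structure VacuumCauchyDevelopment (Choquet-Bruhat–Geroch 1969 Thm 3, Sbierski 2016
Thm 2.6) — the Statement's anti-vacuity conjunct, verbatim the shared item of
RobustClausewiseGenericity / BurnettKineticRigidity / LambdaRegulator (re-asked so that the ledger
attaches this route); conditional closure from the named fact is landed
(Theorems/BurnettKineticRigidityMGHDExistence.mghdExistence_of_choquetBruhatGeroch). [difficulty:
XL] (why it might fail: Paper theorem (CBG 1969, Sbierski 2016), unproved in tree (= undischarged
fact choquetBruhat_geroch_exists_mghd_cauchy; XL); as typed IsMaximal asks every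
VacuumCauchyDevelopment to embed, so a typing slip in the repaired structure could falsify it.)
[ChoquetBruhatGeroch1969CMP, Sbierski2016AHP]
#6 AdmissibleMassNonneg (crux; route-choice promotion 2026-08-17 of the XL named fact
positive_mass_theorem_spacetime, DR-class special case; binder of closes since rev 5) — POSITIVE
MASS THEOREM ON THE ADMISSIBLE VACUUM CLASS: for every X, admissible d, sole end e and M with h =
(1+2M/r)δ + o₂(r⁻¹), k = o₁(r⁻²) on e: 0 ≤ M (vacuum, P_ADM = 0 case; conditional closure from the
fact = massParam_nonneg_of_pmt, p154070). [difficulty: XL] (why it might fail: Known theorem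
(Schoen–Yau 1981, Witten 1981; EHLS 2016 Thm 1), no carrier in Mathlib; only a typing slip in
admissibleVacuumData / IsStronglyAsymptoticallyFlatDR could falsify it.) [SchoenYau1981, Witten1981,
EichmairHuangLeeSchoen2016, SchoenYauPMT1979, arXiv08110354]
#7 ZeroMassAdmissibleMinkowskian (crux; route-choice promotion of positive_mass_rigidity_spacetime;
binder of closes since rev 5) — RIGID POSITIVE ENERGY THEOREM ON THE ADMISSIBLE VACUUM CLASS: an
admissible d that is DR-flat with mass parameter 0 on a sole end has a Cauchy development WHICH IS
Minkowski space-time (`∃ 𝒟 : CauchyDevelopment d, 𝒟.toSpacetime = Minkowski.spacetime`;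
Beig–Chruściel 1996 Thm 4.1, m = 0; conditional closure from the fact alone, cf.
exists_cauchyDevelopment_eq_minkowski_of_pmt, p154070). [difficulty: XL] (why it might fail: Known
theorem, no carrier (Witten spinors / Killing development); as typed the conclusion needs ι(X)
Cauchy for (ℝ⁴, η, ∂ₜ) with the tree's K-sign convention — a convention slip is the one way it
fails.) [BeigChrusciel1996, Witten1981, EichmairHuangLeeSchoen2016, arXiv:1706.03732]
#9 TameEscapeGivenMassTheorems (support — glue, stmt-FinalStateConjecture-18158, route-repair
2026-08-17) — AdmissibleMassNonneg → ZeroMassAdmissibleMinkowskian → TameEscapeToKerrEnds: the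
sorry-free deliverable of E's line matched-kerr-solution-map once its analytic stub S1♭♭ closes
(landed composition tameEscapeToKerrEnds_of_matchedKerrGluing_of_nonposMassKerrEnded with S2 :=
NonposMassKerrEnded from #6 + #7 via hasExactKerrEnd_of_cauchyDevelopment_eq_minkowski; planner
Sketch.lean rc 0); binder of closes, which derives E := G #6 #7; not a separate line (same lead and
skeleton as TameEscapeToKerrEnds). [difficulty: L] [CorvinoSchoen2006, MaoOhTao2023,
BeigChrusciel1996]
#9 ExactKerrFarDevelopment (support) — EXACT KERR FAR DEVELOPMENT (first lemma of both dynamical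
cruxes; provable from domain of dependence + CBG uniqueness, shape of the named fact
KerrLeafExactPartChart). For a Kerr-ended admissible datum with end data (K, U, M, a, r₀, φ, ψ, ν)
and every maximal vacuum Cauchy development 𝒟 there are a compact K' ⊇ K, an open E' ⊇ J⁺(ιX) ∖ J⁺(ι
K') and χ : E' → Kerr.region a r₀, smooth, injective, isometric and time-orientation preserving on
E', with χ(ι(φ y)) = ψ y off K': the far field of the development is an exact piece of the same Kerr
chart. [difficulty: L] [HawkingEllis1973CUP, ChoquetBruhatGeroch1969CMP, Sbierski2016AHP,
CorvinoSchoen2006]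

TWO-LAYER PLAN. RECORDED (rev 5, in the deciding theorem itself): TameEscapeToKerrEnds =
TameEscapeGivenMassTheorems ∧ AdmissibleMassNonneg ∧ ZeroMassAdmissibleMinkowskian (glue
definitional: E := G #6 #7), separating E's gluing analysis (G, staffed through E's line) from the
positive-mass formalisation debt (#6, #7, shared with C₁'s line Sketch v3.4 which cites them by
name). FORESEEN: TameEscapeToKerrEnds ⇐ CorvinoSchoenTameFamily (pure parametric gluing: a tame
admissible family with Kerr-ended members off 0, no
injectivity/immersion) → GaugeUpgrade (compose with a compactly supported breathing gauge far out:
TameBreathingCurve.lean technology;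
Kerr-endedness is stable under compact modifications — enlarge K) → TameEscapeToKerrEnds
(composition PROVED in the birth skeleton).
CensorshipAlongKerrEnds ⇐ CensoredEscapeAtKerrEndedData (constant case = Christodoulou's setting) →
CensoredEscapeAlongKerrEndedCurves
(uniformity as the end recedes) → crux (case split PROVED). SettlingAlongCensoredKerrEnds ⇐ the same
two-case split (PROVED); below it the
usual capture ∧ endgame seam, now over ExactKerrFarDevelopment. MGHDExists ⇐ local existence ∧
common extensions
(Theorems/BurnettKineticRigidityMGHDExistence.mghdExistence_iff_localExistence_and_common_extension,
landed).

KILL CRITERIA. refuted:TameEscapeToKerrEnds through a genuine obstruction to tame Corvino–Schoen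
curves in the DR class (e.g. the weighted C²₋₁ distance of
every Kerr-ended approximant to some admissible d stays ≥ ε) closes the route outright — far-field
rigidification is then unavailable in
the Statement's topology; refuted through the TYPING of KerrEnded (orientation of ν, chart domain,
Kerr.Facts guard) ⇒ misstated, restate
1:1. An operator re-typing of genericity to straight lines in a fixed affine space (no receding
modifications) MOOTS the route (close
superseded/moot) — and, by Negative/FarFieldFocusing, probably the Statement's C² conclusion with
it. refuted:CensorshipAlongKerrEnds by a
tame-stable smooth Kerr-ended naked singularity kills every censorship crux of the summit (hand the
witness to the negative side).
refuted:SettlingAlongCensoredKerrEnds through clause C (rays off closure O on some topology X) is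
`verdict: misstated` upward (the
Statement), through an open set of censored Kerr-ended data with a non-Kerr end state it is
substantive (close refuted). Mooted if a
sibling route proves its generic settling crux for ALL admissible data honestly (then the reduction
was unnecessary, supersede).

NOT DECOMPOSED YET. The dynamics inside C₁ (Christodoulou-type transversality in vacuum) and C₂
(capture + Kerr stability + N-body recession + exhaustive
charts) — every existing engine of the summit can be re-posed on Kerr-ended curves and is a layer-2
child here; the parametric
(IFT) form of Corvino–Schoen; the quasi-isotropic identification of the glued Kerr slice as a DR
end; the M_ADM = 0 rigidity branch of E;
the proof of ExactKerrFarDevelopment from KerrLeafExactPartChart-type facts; a Literature definition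
`HasExactKerrEnd` replacing the
let-bound legend (definition request below).

CHEAPEST FALSIFIER. (i) Paper check of E against CorvinoSchoen2006: Thm 1 (p. 8) needs g − δ =
O(1/r), π = O(1/r²) — the DR class qualifies — and gives
(7) with E,P ε-close; Thm 4 (p. 23) glues an (AC) datum to a member of the Kerr slice family
matching (E,P,J,C) outside E_2R; Thm 5 =
both: confirmed by reading pp. 1, 3, 8, 23 this session; what is NOT printed is smooth dependence on
R (degree argument, p. 23 "I has a
zero") — the crux's stated risk. (ii) In-tree consistency: Kerr–Schild slices are NOT DR
(Kerr.not_isStronglyAsymptoticallyFlatDR_data)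
but bent Boyer–Lindquist ends are (KerrShieldedDataExist/Negative: UnbentEndNotDR vs §7 "CK rates …
survives"), so KerrEnded ∧ admissible
is satisfiable in kind and E is not asking for the impossible. (iii) A refuter's one-hour kill
attempt: find an admissible class member
whose every Kerr-ended approximant has wDist ≥ ε (e.g. slowly decaying o₂(r⁻¹) tails r⁻¹/log r): CS
Thm 1's conformal correction u = 1 +
a/r + O(r⁻²) absorbs only the monopole — the o(r⁻¹) anisotropic remainder of d must be matched by
the cut-off region moving out, which
is exactly why R(c) → ∞ is needed; no obstruction found on paper.

NUMBERS. Decay classes: DR admissible h − (1+2M/r)δ = o₂(r⁻¹), k = o₁(r⁻²) (arXiv08110354 App.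
B.2.3) ⇒ P_ADM = 0, E_ADM = M; Corvino–Schoen
work with g − δ ∈ C^(2,α)_(−q)/W^(2,p)_(−δ), δ ∈ (1/2,1) (CorvinoSchoen2006 p. 3) — DR ⊂ their class
with q = 1; Kerr slice family =
10 parameters (m, a, Poincaré mod 2) (p. 23), here effectively (m, a⃗, centre) since P = 0. Focusing
exponents of the obstruction removed:
F ω² r² → 0 with F ω³ → ∞ (Negative/FarFieldFocusing.focusing_exponents). Items at open: 6 (4 cruxes
incl. the shared MGHDExists, 1 support, 1 assembly); since rev 5: 9 (6 cruxes incl. MGHDExists and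
the two promoted mass theorems #6/#7, 2 support incl. the glue G, 1 assembly); closes: 6 binders (G,
#6, #7, C₁, C₂, M), 29 lines — E derived on line 1, then 2 Literature lemma applications + mono.

DEFINITION REQUESTS. (1) notion HasExactKerrEnd (topic Literature/Geometry/Lorentzian): the
let-bound legend KerrEnded of the items as a definition
`InitialDataSet.HasExactKerrEnd (D : InitialDataSet (𝓡 3) X) : Prop` (exact spacelike Kerr leaf
outside a compact set, ingoing
Kerr–Schild chart, 0 ≤ M, injective ψ, future unit normal, induced h and k), with the two
bookkeeping lemmas the skeletons need:
stability under modification on a compact set, and invariance under pull-back by diffeomorphisms of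
X; then restate the four items 1:1.
(2) cite fact wanted: Corvino–Schoen 2006 Thm 5 in DR weights with continuous (ideally smooth)
dependence on the gluing radius
(CorvinoSchoen2006 + ChruscielDelay2003), to discharge CorvinoSchoenTameFamily.

Novelty: Searches (2026-08-17): `lit search --hybrid "Corvino Schoen asymptotics vacuum Einstein constraint
equations gluing Kerr outside compact set"` (12: Ashtekar–Berger–Isenberg–MacCallum 2015 p. 438
read; Hintz 2210.13960; Kroon; LeFloch–Ma); `lit read doi:10.4310/jdg/1146169910` (CorvinoSchoen2006
pp. 1, 3, 7–8, 23–24 read: Thms 1, 4, 5 and the intro sentence "Having vacuum initial data which is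
identical to Kerr data outside a compact set is important for understanding the global evolution");
`lit galaxy search "Kerr outside a compact set" --star all` (1: Lucietti–Reall), `"Schwarzschild
outside a compact set" --star all` (1: Rendall's book); `lit search --source zbmath "gluing Kerr"`
(10: AretakisCzimekRodnianski2023KerrGluing 2107.02456, CzimekRodnianski2022 2210.09663, Li–Yu
1207.3164, Hintz 2210.13960/2408.06715); `lit frontier FinalStateConjecture --since 2022` (25
newest: 2601.01517 multi-BH Cauchy data with prescribed ADM parameters, Kehrberger V 2401.04179, …);
arXiv/OpenAlex/S2 HTTP 429 this session; in-tree: grep of all 56 theses and 126 cards for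
corvino|exactly kerr outside|far-regular|escape into (CS only as probe tool; burial routes;
disprover's FarFieldFocusing `finalStateConjecture_of_escape` for the OLD genericity = the
suggestion this route makes honest and tame); `ledger negatives` (1, unrelated).
Nearest prior art found: CorvinoSchoen2006 (Thm 5: density of Kerr-ended vacuum data; motivates the
class for evolution but states no final-state reduction); Negati  [refs: 10.4310/jdg/1146169910`, doi:10.4310/jdg/1146169910, CorvinoSchoen2006, CzimekRodnianski2022]

Barriers (technique_class: far-field-gluing, genericity-composition): - technique_class: far-field-gluing, genericity-composition
- Literature.Barriers.FinalStateConjecture.KehrbergerLogarithmicAsymptotics: evaded where it bites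
data — every member evolved has an exactly Kerr far field, so no initial-data-induced logarithmic
tails at early 𝓘⁺ and no conformal smoothness is ever assumed (sojourn completeness); late-time logs
generated in the bulk are untouched and unclaimed.
- Literature.Barriers.FinalStateConjecture.nakedSingularityInstability: respected — genericity is
kept in every item; CensorshipAlongKerrEnds is precisely Christodoulou's positive-codimension form
in a fixed-asymptotics class (compactly supported deviations from a Kerr end), the setting of his
Thm 4.1; the barrier's scope caveat (no smooth vacuum instability theorem) is the crux's
why-might-fail.
- Literature.Barriers.FinalStateConjecture.SlowlyRotatingKerrFrontier: it does not evade it;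
SettlingAlongCensoredKerrEnds inherits the full sub-extremal endgame like every settling crux; the
bet is orthogonal (far field, not spin).
- Literature.Barriers.FinalStateConjecture.KerrSuperradiance: not engaged by E/C₁; enters C₂'s
layer-2 endgame as everywhere.
- Literature.Barriers.FinalStateConjecture.SbierskiTrappingObstruction: not engaged (no decay rate
or regularity budget is fixed at open).
- Literature.Barriers.FinalStateConjecture.PriceLawTail: harmless — no rates asserted (qualitative
C² convergence); exact Kerr ends remove the initial-data tail contribution, the t⁻³ tails from

History (route lifecycle, newest last):
- 2026-08-17T11:33:45Z · rev 2: dropped PositiveMassTheorem — route-repair (cone): drop item PositiveMassTheorem (stmt-FinalStateConjecture-18050) — in the route file it is `def PositiveMassTheorem : Prop := Literature.Geo (planner-rrepair-FinalStateConjecture-ExactKerr-3e59dc4f-0)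
- 2026-08-17T11:35:46Z · rev 3: dropped stmt-FinalStateConjecture-18081 — route-repair (cone), part 2: drop the retracted duplicate stmt-FinalStateConjecture-18081 (decl PositiveMassTheorem := Literature.Geometry.Lorentzian.positive_m (planner-rrepair-FinalStateConjecture-ExactKerr-3e59dc4f-0)
- 2026-08-17T12:22:04Z · rev 5: restated Assembly (stmt-FinalStateConjecture-18524 proved) — route-repair (unused-crux): wire the promoted mass cruxes AdmissibleMassNonneg (stmt-18051) / ZeroMassAdmissibleMinkowskian (stmt-18053) into the deciding theor (planner-rrepair-FinalStateConjecture-ExactKerr-751b7079-0)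

sub-problem: FinalStateConjecture · status: open · opened planner-plan-lens3-FinalStateConjecture-decomp-0 2026-08-17T02:41:00Z · rev 5 · ledger route-FinalStateConjecture-ExactKerrEnds
GENERATED by the gate from the ledger (D-0016/17). Provers cite these decls: `theorem foo : Summit.FinalStateConjecture.FinalStateConjecture.Theses.ExactKerrEnds.<Decl> := …` in Summits/FinalStateConjecture/FinalStateConjecture/Theorems/<Name>.lean.
-/

namespace Summit.FinalStateConjecture.FinalStateConjecture.Theses.ExactKerrEnds

open scoped BigOperators Topology Manifold Classical MeasureTheory ProbabilityTheory Matrix InnerProductSpace ComplexConjugate ContinuousMap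
open Filter Set Function TopologicalSpace MeasureTheory

attribute [summit_statement] _root_.FinalStateConjecture

/-- item stmt-FinalStateConjecture-18520 · crux · rank 2 · open · by planner
why it might fail: Settling half of FSC in the Kerr-ended class: an open set of censored Kerr-ended data with a non-Kerr ω-limit, eternal binaries, tame-stable extremal remnants, or failure of clause C (rays off closure O) on some X refutes it; uniformity as R(c)→∞ may fail.
sources: DafermosLuk2017, KlainermanSzeftel2023, DafermosHolzegelRodnianskiTaylor2021, CorvinoSchoen2006, DafermosRodnianski2010ICMP, Moschidis2016
[crux] SETTLING ALONG CENSORED KERR-ENDED CURVES. For every X, every end e and every tame curve F of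
admissible data on e which is either immersed at 0 and injective or constant, and whose members off
0 are Kerr-ended and censored (every MGHD has complete 𝓘⁺), there are an end e' and a tame,
injective, immersed curve F' of admissible data on e' with F' 0 = F 0 whose members off 0 satisfy
the settling clause of the Statement for EVERY maximal development: complete 𝓘⁺ and an N-Kerr
FinalStateDecomposition in C² of O = exteriorOf with sub-extremal holes, RaysStayInClosure,
HasExhaustiveCharts (honest radii) and IsFutureOriented. The base datum F 0 is arbitrary (approached
by Kerr-ended data as the end recedes) but is never itself evolved. Carries the difficulty of the
route (the large-data settling problem for compactly supported deviations from exact Kerr ends,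
uniformly along tame curves); first lemma = support ExactKerrFarDevelopment. [difficulty:
open-problem] -/
@[route_item "route-FinalStateConjecture-ExactKerrEnds", crux]
def SettlingAlongCensoredKerrEnds : Prop :=
  ∀ (X : Type) [TopologicalSpace X] [ChartedSpace Literature.Geometry.Lorentzian.E3 X] [IsManifold (𝓡 3) ((⊤ : ℕ∞) : WithTop ℕ∞) X] [T2Space X] [SecondCountableTopology X] [ConnectedSpace X], let KerrEnded : Literature.Geometry.Lorentzian.InitialDataSet (𝓡 3) X → Prop := fun D ↦ ∀ [Literature.Geometry.Lorentzian.Kerr.Facts], ∃ (K : Set X) (U : Opens Literature.Geometry.Lorentzian.E3) (M a r₀ : ℝ) (hM : 0 ≤ M) (φ : U → X) (ψ : U → Literature.Geometry.Lorentzian.Kerr.region a r₀) (ν : Literature.Geometry.Lorentzian.NormalField 𝓘(ℝ, Literature.Geometry.Lorentzian.E4) ψ), IsCompact K ∧ Kᶜ ⊆ range φ ∧ Topology.IsOpenEmbedding φ ∧ ContMDiff 𝓘(ℝ, Literature.Geometry.Lorentzian.E3) (𝓡 3) ((⊤ : ℕ∞) : WithTop ℕ∞) φ ∧ Injective ψ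 ∧ (Literature.Geometry.Lorentzian.Kerr.smoothMetric M a r₀).IsSpacelikeImmersion 𝓘(ℝ, Literature.Geometry.Lorentzian.E3) ψ ∧ (Literature.Geometry.Lorentzian.Kerr.smoothMetric M a r₀).IsFutureUnitNormal 𝓘(ℝ, Literature.Geometry.Lorentzian.E3) ((Literature.Geometry.Lorentzian.Kerr.timeOrientation M a r₀ hM).ofLE le_top) ψ ν ∧ (∀ (y : U) (v w : Literature.Geometry.Lorentzian.E3), φ y ∉ K → D.h.inner (φ y) (mfderiv 𝓘(ℝ, Literature.Geometry.Lorentzian.E3) (𝓡 3) φ y v) (mfderiv 𝓘(ℝ, Literature.Geometry.Lorentzian.E3) (𝓡 3) φ y w) = Literature.Geometry.Lorentzian.Kerr.bilin M a (ψ y : Literature.Geometry.Lorentzian.E4) (mfderiv 𝓘(ℝ, Literature.Geometry.Lorentzian.E3) 𝓘(ℝ, Literature.Geometry.Lorentzian.E4) ψ y v) (mfderiv 𝓘(ℝ, Literature.Geometry.Lorentzian.E3) 𝓘(ℝ, Literature.Geometry.Lorentzian.E4) ψ y w)) ∧ (∀ [(Literature.Geometry.Lorentzian.Kerr.smoothMetric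 M a r₀).HasLeviCivita] (y : U) (v w : Literature.Geometry.Lorentzian.E3), φ y ∉ K → D.k (φ y) (mfderiv 𝓘(ℝ, Literature.Geometry.Lorentzian.E3) (𝓡 3) φ y v) (mfderiv 𝓘(ℝ, Literature.Geometry.Lorentzian.E3) (𝓡 3) φ y w) = (Literature.Geometry.Lorentzian.Kerr.smoothMetric M a r₀).secondFundamentalForm 𝓘(ℝ, Literature.Geometry.Lorentzian.E3) ψ ν y v w); let Censored : Literature.Geometry.Lorentzian.InitialDataSet (𝓡 3) X → Prop := fun D ↦ ∀ 𝒟 : Literature.Geometry.Lorentzian.VacuumCauchyDevelopment D, 𝒟.IsMaximal → Summit.FinalStateConjecture.HasCompleteNullInfinity 𝒟.toCauchyDevelopment; let Settled : Literature.Geometry.Lorentzian.InitialDataSet (𝓡 3) X → Prop := fun D ↦ ∀ 𝒟 : Literature.Geometry.Lorentzian.VacuumCauchyDevelopment D, 𝒟.IsMaximal → Summit.FinalStateConjecture.HasCompleteNullInfinity 𝒟.toCauchyDevelopment ∧ ∃ (O : Set 𝒟.carrier) (d : Literature.Geometry.Lorentzian.FinalStateDecomposition 𝒟.toSpacetime O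 2), (∀ i, Literature.Geometry.Lorentzian.Kerr.IsSubextremal (d.mass i) (d.spin i)) ∧ O = Summit.FinalStateConjecture.exteriorOf 𝒟.toCauchyDevelopment d.charted ∧ Summit.FinalStateConjecture.RaysStayInClosure 𝒟.toCauchyDevelopment O ∧ Summit.FinalStateConjecture.HasExhaustiveCharts d ∧ Summit.FinalStateConjecture.IsFutureOriented d; ∀ (e : Literature.Geometry.Lorentzian.AFEnd X) (F : EuclideanSpace ℝ (Fin 1) → Literature.Geometry.Lorentzian.InitialDataSet (𝓡 3) X), Literature.Geometry.Lorentzian.InitialDataSet.IsTameDataFamily e 1 F → ((Literature.Geometry.Lorentzian.InitialDataSet.IsImmersedAtZero 1 F ∧ Injective F) ∨ ∀ c, F c = F 0) → (∀ c, F c ∈ Literature.Geometry.Lorentzian.admissibleVacuumData X) → (∀ c ≠ 0, KerrEnded (F c) ∧ Censored (F c)) → ∃ (e' : Literature.Geometry.Lorentzian.AFEnd X) (F' : EuclideanSpace ℝ (Fin 1) → Literature.Geometry.Lorentzian.InitialDataSet (𝓡 3) X), Literature.Geometry.Lorentzian.InitialDataSet.IsTameDataFamily e' 1 F' ∧ F'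 0 = F 0 ∧ Injective F' ∧ Literature.Geometry.Lorentzian.InitialDataSet.IsImmersedAtZero 1 F' ∧ (∀ c, F' c ∈ Literature.Geometry.Lorentzian.admissibleVacuumData X) ∧ ∀ c ≠ 0, Settled (F' c)

/-- item stmt-FinalStateConjecture-18521 · crux · rank 3 · open · by planner
why it might fail: A smooth Kerr-ended vacuum datum forming a naked singularity STABLY under tame Kerr-ended perturbations kills it (RSR examples are C^N, expected non-generic; instability proved only for the spherical scalar field in BV); or loss of uniformity of the transversal direction as R(c)→∞.
sources: Christodoulou1999, Christodoulou1999instability, RodnianskiShlapentokhRothman2023, CorvinoSchoen2006, DafermosLuk2017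
[crux] CENSORSHIP ALONG KERR-ENDED CURVES (weak cosmic censorship in positive tame codimension
inside the Kerr-ended class, relative form). For every X, end e and tame curve F of admissible data
on e, immersed-injective or constant, whose members off 0 are Kerr-ended, there are e' and a tame,
injective, immersed curve F' of admissible data with F' 0 = F 0 whose members off 0 are Kerr-ended
AND censored (every maximal vacuum Cauchy development has complete future null infinity in the
sojourn form). In the constant case the base datum is Kerr-ended and this is Christodoulou's
positive-codimension censorship for compactly supported deviations from an exact Kerr end (his fixed
space 𝓐); in the curve case it asks the censored escape to be chosen uniformly as the Kerr end
recedes towards an arbitrary admissible datum. [difficulty: open-problem] -/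
@[route_item "route-FinalStateConjecture-ExactKerrEnds", crux]
def CensorshipAlongKerrEnds : Prop :=
  ∀ (X : Type) [TopologicalSpace X] [ChartedSpace Literature.Geometry.Lorentzian.E3 X] [IsManifold (𝓡 3) ((⊤ : ℕ∞) : WithTop ℕ∞) X] [T2Space X] [SecondCountableTopology X] [ConnectedSpace X], let KerrEnded : Literature.Geometry.Lorentzian.InitialDataSet (𝓡 3) X → Prop := fun D ↦ ∀ [Literature.Geometry.Lorentzian.Kerr.Facts], ∃ (K : Set X) (U : Opens Literature.Geometry.Lorentzian.E3) (M a r₀ : ℝ) (hM : 0 ≤ M) (φ : U → X) (ψ : U → Literature.Geometry.Lorentzian.Kerr.region a r₀) (ν : Literature.Geometry.Lorentzian.NormalField 𝓘(ℝ, Literature.Geometry.Lorentzian.E4) ψ), IsCompact K ∧ Kᶜ ⊆ range φ ∧ Topology.IsOpenEmbedding φ ∧ ContMDiff 𝓘(ℝ, Literature.Geometry.Lorentzian.E3) (𝓡 3) ((⊤ : ℕ∞) : WithTop ℕ∞) φ ∧ Injective ψ ∧ (Literature.Geometry.Lorentzian.Kerr.smoothMetric M a r₀).IsSpacelikeImmersion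 𝓘(ℝ, Literature.Geometry.Lorentzian.E3) ψ ∧ (Literature.Geometry.Lorentzian.Kerr.smoothMetric M a r₀).IsFutureUnitNormal 𝓘(ℝ, Literature.Geometry.Lorentzian.E3) ((Literature.Geometry.Lorentzian.Kerr.timeOrientation M a r₀ hM).ofLE le_top) ψ ν ∧ (∀ (y : U) (v w : Literature.Geometry.Lorentzian.E3), φ y ∉ K → D.h.inner (φ y) (mfderiv 𝓘(ℝ, Literature.Geometry.Lorentzian.E3) (𝓡 3) φ y v) (mfderiv 𝓘(ℝ, Literature.Geometry.Lorentzian.E3) (𝓡 3) φ y w) = Literature.Geometry.Lorentzian.Kerr.bilin M a (ψ y : Literature.Geometry.Lorentzian.E4) (mfderiv 𝓘(ℝ, Literature.Geometry.Lorentzian.E3) 𝓘(ℝ, Literature.Geometry.Lorentzian.E4) ψ y v) (mfderiv 𝓘(ℝ, Literature.Geometry.Lorentzian.E3) 𝓘(ℝ, Literature.Geometry.Lorentzian.E4) ψ y w)) ∧ (∀ [(Literature.Geometry.Lorentzian.Kerr.smoothMetric M a r₀).HasLeviCivita] (y : U) (v w : Literature.Geometry.Lorentzian.E3), φ y ∉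 K → D.k (φ y) (mfderiv 𝓘(ℝ, Literature.Geometry.Lorentzian.E3) (𝓡 3) φ y v) (mfderiv 𝓘(ℝ, Literature.Geometry.Lorentzian.E3) (𝓡 3) φ y w) = (Literature.Geometry.Lorentzian.Kerr.smoothMetric M a r₀).secondFundamentalForm 𝓘(ℝ, Literature.Geometry.Lorentzian.E3) ψ ν y v w); let Censored : Literature.Geometry.Lorentzian.InitialDataSet (𝓡 3) X → Prop := fun D ↦ ∀ 𝒟 : Literature.Geometry.Lorentzian.VacuumCauchyDevelopment D, 𝒟.IsMaximal → Summit.FinalStateConjecture.HasCompleteNullInfinity 𝒟.toCauchyDevelopment; ∀ (e : Literature.Geometry.Lorentzian.AFEnd X) (F : EuclideanSpace ℝ (Fin 1) → Literature.Geometry.Lorentzian.InitialDataSet (𝓡 3) X), Literature.Geometry.Lorentzian.InitialDataSet.IsTameDataFamily e 1 F → ((Literature.Geometry.Lorentzian.InitialDataSet.IsImmersedAtZero 1 F ∧ Injective F) ∨ ∀ c, F c = F 0) → (∀ c, F c ∈ Literature.Geometry.Lorentzian.admissibleVacuumData X) → (∀ c ≠ 0, KerrEnded (F c)) → ∃ (e'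 : Literature.Geometry.Lorentzian.AFEnd X) (F' : EuclideanSpace ℝ (Fin 1) → Literature.Geometry.Lorentzian.InitialDataSet (𝓡 3) X), Literature.Geometry.Lorentzian.InitialDataSet.IsTameDataFamily e' 1 F' ∧ F' 0 = F 0 ∧ Injective F' ∧ Literature.Geometry.Lorentzian.InitialDataSet.IsImmersedAtZero 1 F' ∧ (∀ c, F' c ∈ Literature.Geometry.Lorentzian.admissibleVacuumData X) ∧ ∀ c ≠ 0, KerrEnded (F' c) ∧ Censored (F' c)

/-- item stmt-FinalStateConjecture-18522 · crux · rank 4 · open · by planner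
why it might fail: Corvino–Schoen's degree argument gives no smooth dependence of the Kerr parameters on the gluing radius (joint smoothness in c needs an IFT form, Chruściel–Delay); Thm 1's harmonic-asymptotics correction must be o(1) in DR weights for wDist→0; M_ADM=0 needs the rigidity branch.
sources: CorvinoSchoen2006, Corvino2000, ChruscielDelay2003, AretakisCzimekRodnianski2023KerrGluing, CzimekRodnianski2022, MaoOhTao2023
[crux] KERR-ENDEDNESS IS TAME-GENERIC (Corvino–Schoen density by tame curves). For every X, the set
of admissible data that are NOT Kerr-ended has tame codimension ≥ 1 in admissibleVacuumData X:
through every such datum d passes a one-parameter family F of admissible data, tame on one fixed end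
(jointly smooth, DR rates with continuous mass, weighted-C²₋₁×C¹₋₂-continuous at 0), injective,
immersed at 0, F 0 = d, whose members off 0 are Kerr-ended. Intended witness: F c = (breathing gauge
σ(c))^* of the Corvino–Schoen gluing of d to a Kerr slice beyond radius R(c) → ∞ (CorvinoSchoen2006
Thm 1 + Thm 4; mass m(c) → M_ADM(d); P_ADM = 0 in the DR class so the end is an unboosted,
quasi-isotropic Boyer–Lindquist-type leaf, which IS DR-admissible — KerrShieldedDataExist/Negative:
bent BL ends have h − (1+2M/ρ)δ = O(ρ⁻²), k = O(aMρ⁻³)). [difficulty: L] -/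
@[route_item "route-FinalStateConjecture-ExactKerrEnds", crux]
def TameEscapeToKerrEnds : Prop :=
  ∀ (X : Type) [TopologicalSpace X] [ChartedSpace Literature.Geometry.Lorentzian.E3 X] [IsManifold (𝓡 3) ((⊤ : ℕ∞) : WithTop ℕ∞) X] [T2Space X] [SecondCountableTopology X] [ConnectedSpace X], let KerrEnded : Literature.Geometry.Lorentzian.InitialDataSet (𝓡 3) X → Prop := fun D ↦ ∀ [Literature.Geometry.Lorentzian.Kerr.Facts], ∃ (K : Set X) (U : Opens Literature.Geometry.Lorentzian.E3) (M a r₀ : ℝ) (hM : 0 ≤ M) (φ : U → X) (ψ : U → Literature.Geometry.Lorentzian.Kerr.region a r₀) (ν : Literature.Geometry.Lorentzian.NormalField 𝓘(ℝ, Literature.Geometry.Lorentzian.E4) ψ), IsCompact K ∧ Kᶜ ⊆ range φ ∧ Topology.IsOpenEmbedding φ ∧ ContMDiff 𝓘(ℝ, Literature.Geometry.Lorentzian.E3) (𝓡 3) ((⊤ : ℕ∞) : WithTop ℕ∞) φ ∧ Injective ψ ∧ (Literature.Geometry.Lorentzian.Kerr.smoothMetric M a r₀).IsSpacelikeImmersion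 𝓘(ℝ, Literature.Geometry.Lorentzian.E3) ψ ∧ (Literature.Geometry.Lorentzian.Kerr.smoothMetric M a r₀).IsFutureUnitNormal 𝓘(ℝ, Literature.Geometry.Lorentzian.E3) ((Literature.Geometry.Lorentzian.Kerr.timeOrientation M a r₀ hM).ofLE le_top) ψ ν ∧ (∀ (y : U) (v w : Literature.Geometry.Lorentzian.E3), φ y ∉ K → D.h.inner (φ y) (mfderiv 𝓘(ℝ, Literature.Geometry.Lorentzian.E3) (𝓡 3) φ y v) (mfderiv 𝓘(ℝ, Literature.Geometry.Lorentzian.E3) (𝓡 3) φ y w) = Literature.Geometry.Lorentzian.Kerr.bilin M a (ψ y : Literature.Geometry.Lorentzian.E4) (mfderiv 𝓘(ℝ, Literature.Geometry.Lorentzian.E3) 𝓘(ℝ, Literature.Geometry.Lorentzian.E4) ψ y v) (mfderiv 𝓘(ℝ, Literature.Geometry.Lorentzian.E3) 𝓘(ℝ, Literature.Geometry.Lorentzian.E4) ψ y w)) ∧ (∀ [(Literature.Geometry.Lorentzian.Kerr.smoothMetric M a r₀).HasLeviCivita] (y : U) (v w : Literature.Geometry.Lorentzian.E3), φ y ∉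 K → D.k (φ y) (mfderiv 𝓘(ℝ, Literature.Geometry.Lorentzian.E3) (𝓡 3) φ y v) (mfderiv 𝓘(ℝ, Literature.Geometry.Lorentzian.E3) (𝓡 3) φ y w) = (Literature.Geometry.Lorentzian.Kerr.smoothMetric M a r₀).secondFundamentalForm 𝓘(ℝ, Literature.Geometry.Lorentzian.E3) ψ ν y v w); Literature.Geometry.Lorentzian.InitialDataSet.IsTameChristodoulouGeneric (Literature.Geometry.Lorentzian.admissibleVacuumData X) KerrEnded 1

/-- item stmt-FinalStateConjecture-9937 · crux · rank 5 · open · by planner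
why it might fail: Paper theorem (CBG 1969, Sbierski 2016), unproved in tree (= undischarged fact choquetBruhat_geroch_exists_mghd_cauchy; XL); as typed IsMaximal asks every VacuumCauchyDevelopment to embed, so a typing slip in the repaired structure could falsify it.
sources: ChoquetBruhatGeroch1969CMP, Sbierski2016AHP
[support] every admissible datum has a maximal globally hyperbolic vacuum development, stated over
the repaired structure `VacuumCauchyDevelopment` (the corrected form of the deprecated
`choquetBruhat_geroch_exists_mghd`, recorded in `CauchyProblemExistenceDefect`);
Choquet-Bruhat–Geroch 1969 Thm. 3, Sbierski 2016 Thm. 2.6. Known theorem; large formalisation;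
shared by every route of this summit. [difficulty: XL] -/
@[route_item "route-FinalStateConjecture-ExactKerrEnds", crux]
def MGHDExists : Prop :=
  ∀ (X : Type) [TopologicalSpace X] [ChartedSpace Literature.Geometry.Lorentzian.E3 X] [IsManifold (𝓡 3) ((⊤ : ℕ∞) : WithTop ℕ∞) X] [T2Space X] [SecondCountableTopology X] [ConnectedSpace X], ∀ D ∈ Literature.Geometry.Lorentzian.admissibleVacuumData X, ∃ 𝒟 : Literature.Geometry.Lorentzian.VacuumCauchyDevelopment D, 𝒟.IsMaximal

/-- item stmt-FinalStateConjecture-18051 · crux · rank 6 · open · by planner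
why it might fail: Known theorem (Schoen–Yau 1981, Witten 1981; EHLS 2016 Thm 1), no carrier in Mathlib: XL (Jang/GMT or Witten spinor theory on AF ends). Weaker than positive_mass_theorem_spacetime (vacuum, P = 0): only a typing slip in admissibleVacuumData / IsStronglyAsymptoticallyFlatDR could falsify it.
sources: SchoenYau1981, Witten1981, EichmairHuangLeeSchoen2016, SchoenYauPMT1979, arXiv08110354
[crux] POSITIVE MASS THEOREM ON THE ADMISSIBLE VACUUM CLASS — route-choice promotion (2026-08-17) of
the XL named fact `Literature.Geometry.Lorentzian.positive_mass_theorem_spacetime`, which had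
entered the cone of cruxes CensorshipAlongKerrEnds (line Sketch: stub_positiveMassTheorem;
Theorems/ExactKerrEndsCensorshipAlongKerrEndsNonposMassCensored, p154070) and TameEscapeToKerrEnds
(S2 NonposMassKerrEnded; Theorems/ExactKerrEndsTameEscapeToKerrEndsNonposMass, p153305) as a bare
hypothesis that no seat may split. For every X, every admissible vacuum datum d (smooth, vacuum
constraints, complete), every end e which is the sole end of X and every M with h = (1+2M/r)δ +
o₂(r⁻¹), k = o₁(r⁻²) on e: 0 ≤ M. This is the VACUUM, P_ADM = 0 special case of the spacetime
positive mass theorem (E_ADM = M by IsStronglyAsymptoticallyFlatDR.hasADMEnergy, P_ADM = 0 by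
hasADMMomentum_zero, DEC with vanishing sources by VacuumDataDominantEnergy): conditional closure
from the named fact = the landed massParam_nonneg_of_pmt (p154070), to be re-landed as `theorem … :
positive_mass_theorem_spacetime → AdmissibleMassNonneg` (MGHDExists pattern; planner Sketch.lean rc
0); unconditional proofs: Schoen–Yau 19 -/
@[route_item "route-FinalStateConjecture-ExactKerrEnds", crux]
def AdmissibleMassNonneg : Prop :=
  ∀ (X : Type) [TopologicalSpace X] [ChartedSpace Literature.Geometry.Lorentzian.E3 X] [IsManifold (𝓡 3) ((⊤ : ℕ∞) : WithTop ℕ∞) X] [T2Space X] [SecondCountableTopology X] [ConnectedSpace X], ∀ d ∈ Literature.Geometry.Lorentzian.admissibleVacuumData X, ∀ (e : Literature.Geometry.Lorentzian.AFEnd X) (M : ℝ), e.IsSoleEnd → e.IsStronglyAsymptoticallyFlatDR d M → 0 ≤ M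

/-- item stmt-FinalStateConjecture-18053 · crux · rank 7 · open · by planner
why it might fail: Known theorem (Beig–Chruściel 1996 Thm 4.1, m = 0), no carrier: XL (Witten spinors, Killing development, flat + complete ⇒ Minkowski). As typed the conclusion needs ι(X) Cauchy for (ℝ⁴, η, ∂ₜ) in O'Neill's sense with the tree's K-sign convention — a convention slip there is the one way it fails.
sources: BeigChrusciel1996, Witten1981, EichmairHuangLeeSchoen2016, arXiv:1706.03732, SchoenYau1981
[crux] RIGID POSITIVE ENERGY THEOREM ON THE ADMISSIBLE VACUUM CLASS — route-choice promotion
(2026-08-17) of the XL named fact `Literature.Geometry.Lorentzian.positive_mass_rigidity_spacetime`,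
the companion of the PMT fact in the SAME stubs (stub_positiveMassRigidity of C₁'s line Sketch; S2
of E's line). For every X, every admissible vacuum datum d and every sole end e on which d is
Dafermos–Rodnianski-flat with mass parameter 0 (h = δ + o₂(r⁻¹), k = o₁(r⁻²)): d has a Cauchy
development WHICH IS Minkowski space-time (ℝ⁴, η, ∂ₜ) — a smooth embedding ι : X → ℝ⁴ with future
unit normal, ι^*η = h, K = k and ι(X) a Cauchy hypersurface (`∃ 𝒟 : CauchyDevelopment d,
𝒟.toSpacetime = Minkowski.spacetime`, the conclusion shape of the Literature fact). VACUUM, E_ADM =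
0 special case of Beig–Chruściel 1996 Thm 4.1 (spinorial; the DR decay α = 1 > 1/2 with one more
derivative suffices, whereas the non-spinor equality proofs — Schoen–Yau 1981 II, Eichmair 2013,
Huang–Lee 2020 — need tr k = O(r^{-γ}), γ > 2, beyond the DR class). Conditional closure from the
named fact ALONE (no PMT at M = 0): the fact applied with
satisfiesDominantEnergyCondition_of_mem_admissibleVacuumData, IsAsymptoticallyFlat -/
@[route_item "route-FinalStateConjecture-ExactKerrEnds", crux]
def ZeroMassAdmissibleMinkowskian : Prop :=
  ∀ (X : Type) [TopologicalSpace X] [ChartedSpace Literature.Geometry.Lorentzian.E3 X] [IsManifold (𝓡 3) ((⊤ : ℕ∞) : WithTop ℕ∞) X] [T2Space X] [SecondCountableTopology X] [ConnectedSpace X], ∀ d ∈ Literature.Geometry.Lorentzian.admissibleVacuumData X, ∀ (e : Literature.Geometry.Lorentzian.AFEnd X), e.IsSoleEnd → e.IsStronglyAsymptoticallyFlatDR d 0 → ∃ 𝒟 : Literature.Geometry.Lorentzian.CauchyDevelopment d, 𝒟.toSpacetime = Literature.Geometry.Lorentzian.Minkowski.spacetime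

/-- item stmt-FinalStateConjecture-18158 · support · rank 9 · open · by planner
[support — glue] TAME ESCAPE GIVEN THE MASS THEOREMS (route-repair 2026-08-17, unused-crux):
AdmissibleMassNonneg → ZeroMassAdmissibleMinkowskian → TameEscapeToKerrEnds. Route-level wiring of
the two promoted positive-mass cruxes (#6 stmt-18051, #7 stmt-18053) into the deciding theorem: the
nonpositive-mass branch of E IS #6 ∧ #7 — an admissible datum with DR mass parameter M ≤ 0 on its
sole end has M = 0 (#6) and a Cauchy development which is Minkowski space (#7), hence is Kerr-ended
(landed hasExactKerrEnd_of_cauchyDevelopment_eq_minkowski,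
Theorems/ExactKerrEndsTameEscapeToKerrEndsMinkowskiLeaf; = registered stub S2 NonposMassKerrEnded of
line matched-kerr-solution-map, planner Sketch.lean rc 0, no Literature PMT fact used) — so E's line
delivers exactly THIS implication sorry-free once its analytic stub S1♭♭ (unit-scale matched
exterior Kerr gluing curve) closes: landed composition
tameEscapeToKerrEnds_of_matchedKerrGluing_of_nonposMassKerrEnded
(Theorems/ExactKerrEndsTameEscapeToKerrEndsOfStubs; curve/unit-scale forms p154413, p155747) with S2
:= nonposMassKerrEnded_of_items (Sketch.lean: `tameEscapeGivenMassTheorems_of_matchedKerrGluing`, rc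
0). NOT a new line and not separat -/
@[route_item "route-FinalStateConjecture-ExactKerrEnds", crux]
def TameEscapeGivenMassTheorems : Prop :=
  AdmissibleMassNonneg → ZeroMassAdmissibleMinkowskian → TameEscapeToKerrEnds

/-- item stmt-FinalStateConjecture-18523 · support · rank 9 · open · by planner
sources: HawkingEllis1973CUP, ChoquetBruhatGeroch1969CMP, Sbierski2016AHP, CorvinoSchoen2006
[support] EXACT KERR FAR DEVELOPMENT (first lemma of both dynamical cruxes; provable from domain of
dependence + CBG uniqueness, shape of the named fact KerrLeafExactPartChart). For a Kerr-ended
admissible datum with end data (K, U, M, a, r₀, φ, ψ, ν) and every maximal vacuum Cauchy development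
𝒟 there are a compact K' ⊇ K, an open E' ⊇ J⁺(ιX) ∖ J⁺(ι K') and χ : E' → Kerr.region a r₀, smooth,
injective, isometric and time-orientation preserving on E', with χ(ι(φ y)) = ψ y off K': the far
field of the development is an exact piece of the same Kerr chart. [difficulty: L] -/
@[route_item "route-FinalStateConjecture-ExactKerrEnds"]
def ExactKerrFarDevelopment : Prop :=
  ∀ (X : Type) [TopologicalSpace X] [ChartedSpace Literature.Geometry.Lorentzian.E3 X] [IsManifold (𝓡 3) ((⊤ : ℕ∞) : WithTop ℕ∞) X] [T2Space X] [SecondCountableTopology X] [ConnectedSpace X], ∀ [Literature.Geometry.Lorentzian.Kerr.Facts], ∀ D ∈ Literature.Geometry.Lorentzian.admissibleVacuumData X, ∀ (K : Set X) (U : Opens Literature.Geometry.Lorentzian.E3) (M a r₀ : ℝ) (hM : 0 ≤ M) (φ : U → X) (ψ : U → Literature.Geometry.Lorentzian.Kerr.region a r₀) (ν : Literature.Geometry.Lorentzian.NormalField 𝓘(ℝ, Literature.Geometry.Lorentzian.E4) ψ), (IsCompact K ∧ Kᶜ ⊆ range φ ∧ Topology.IsOpenEmbedding φ ∧ ContMDiff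 𝓘(ℝ, Literature.Geometry.Lorentzian.E3) (𝓡 3) ((⊤ : ℕ∞) : WithTop ℕ∞) φ ∧ Injective ψ ∧ (Literature.Geometry.Lorentzian.Kerr.smoothMetric M a r₀).IsSpacelikeImmersion 𝓘(ℝ, Literature.Geometry.Lorentzian.E3) ψ ∧ (Literature.Geometry.Lorentzian.Kerr.smoothMetric M a r₀).IsFutureUnitNormal 𝓘(ℝ, Literature.Geometry.Lorentzian.E3) ((Literature.Geometry.Lorentzian.Kerr.timeOrientation M a r₀ hM).ofLE le_top) ψ ν ∧ (∀ (y : U) (v w : Literature.Geometry.Lorentzian.E3), φ y ∉ K → D.h.inner (φ y) (mfderiv 𝓘(ℝ, Literature.Geometry.Lorentzian.E3) (𝓡 3) φ y v) (mfderiv 𝓘(ℝ, Literature.Geometry.Lorentzian.E3) (𝓡 3) φ y w) = Literature.Geometry.Lorentzian.Kerr.bilin M a (ψ y : Literature.Geometry.Lorentzian.E4) (mfderiv 𝓘(ℝ, Literature.Geometry.Lorentzian.E3) 𝓘(ℝ, Literature.Geometry.Lorentzian.E4) ψ y v) (mfderiv 𝓘(ℝ, Literature.Geometry.Lorentzian.E3)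 𝓘(ℝ, Literature.Geometry.Lorentzian.E4) ψ y w)) ∧ (∀ [(Literature.Geometry.Lorentzian.Kerr.smoothMetric M a r₀).HasLeviCivita] (y : U) (v w : Literature.Geometry.Lorentzian.E3), φ y ∉ K → D.k (φ y) (mfderiv 𝓘(ℝ, Literature.Geometry.Lorentzian.E3) (𝓡 3) φ y v) (mfderiv 𝓘(ℝ, Literature.Geometry.Lorentzian.E3) (𝓡 3) φ y w) = (Literature.Geometry.Lorentzian.Kerr.smoothMetric M a r₀).secondFundamentalForm 𝓘(ℝ, Literature.Geometry.Lorentzian.E3) ψ ν y v w)) → ∀ 𝒟 : Literature.Geometry.Lorentzian.VacuumCauchyDevelopment D, 𝒟.IsMaximal → ∃ (K' : Set X) (E' : Set 𝒟.carrier) (χ : 𝒟.carrier → Literature.Geometry.Lorentzian.Kerr.region a r₀), IsCompact K' ∧ K ⊆ K' ∧ (𝒟.metric.causalFuture 𝒟.timeOrientation (range 𝒟.embed) \ 𝒟.metric.causalFuture 𝒟.timeOrientation (𝒟.embed '' K')) ⊆ E' ∧ IsOpen E' ∧ ContMDiffOn (𝓡 4) (𝓡 4) ((⊤ : ℕ∞)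 : WithTop ℕ∞) χ E' ∧ InjOn χ E' ∧ (∀ p ∈ E', (∀ v w, Literature.Geometry.Lorentzian.Kerr.bilin M a (χ p : Literature.Geometry.Lorentzian.E4) (mfderiv (𝓡 4) (𝓡 4) χ p v) (mfderiv (𝓡 4) (𝓡 4) χ p w) = 𝒟.metric.val p v w) ∧ (Literature.Geometry.Lorentzian.Kerr.spacetime M a r₀ hM).timeOrientation.IsFutureDirected (mfderiv (𝓡 4) (𝓡 4) χ p (𝒟.timeOrientation.vectorField p))) ∧ ∀ y : U, φ y ∉ K' → 𝒟.embed (φ y) ∈ E' ∧ χ (𝒟.embed (φ y)) = ψ y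

-- earlier Assembly (stmt-FinalStateConjecture-18524, replaced 2026-08-17T12:22:04Z -> stmt-FinalStateConjecture-18166): proved by Summit.FinalStateConjecture.FinalStateConjecture.Theorems.ExactKerrEnds.assembly_proof @ 89c4ad234a1c — TameEscapeToKerrEnds → CensorshipAlongKerrEnds → SettlingAlongCensoredKerrEnds → MGHDExists → FinalStateConjecture
/-- item stmt-FinalStateConjecture-18166 · assembly · rank 1 · closed · proved by Summit.FinalStateConjecture.FinalStateConjecture.Theorems.ExactKerrEnds.assembly_proof (prover) · by planner
sources: Christodoulou1999, CorvinoSchoen2006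
[assembly] TameEscapeGivenMassTheorems → AdmissibleMassNonneg → ZeroMassAdmissibleMinkowskian →
CensorshipAlongKerrEnds → SettlingAlongCensoredKerrEnds → MGHDExists → FinalStateConjecture — the
type of the deciding theorem `closes` since rev 5 (route-repair 2026-08-17: E = TameEscapeToKerrEnds
enters through its line deliverable G = TameEscapeGivenMassTheorems and the two promoted
positive-mass cruxes, E := G #6 #7 on the first line of `closes`). Restated 1:1 from the rev-1 shape
E → C₁ → C₂ → M → FinalStateConjecture; `Theorems/ExactKerrEndsAssembly.assembly_proof` (`unfold
Assembly; intro hE hC hS hM; exact closes hE hC hS hM`) proves the restated item verbatim by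
positional application of the 6-ary `closes` (planner Sketch2.lean, lean rc 0). [sources:
Christodoulou1999, CorvinoSchoen2006] -/
@[route_item "route-FinalStateConjecture-ExactKerrEnds"]
def Assembly : Prop :=
  TameEscapeGivenMassTheorems → AdmissibleMassNonneg → ZeroMassAdmissibleMinkowskian → CensorshipAlongKerrEnds → SettlingAlongCensoredKerrEnds → MGHDExists → FinalStateConjecture

/-! D-0027 §2.1 — DECIDING THEOREM (planner-authored via `route open/edit --closes-file`; by planner-rrepair-FinalStateConjecture-ExactKerr-751b7079-0 2026-08-17T12:22:04Z):
its hypotheses are this route's items and its conclusion the sub-problem Statement (glue_lint), and it elaborates with this file. -/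

@[closes "route-FinalStateConjecture-ExactKerrEnds"] theorem closes (hG : TameEscapeGivenMassTheorems) (hP : AdmissibleMassNonneg)
    (hZ : ZeroMassAdmissibleMinkowskian) (hC : CensorshipAlongKerrEnds)
    (hS : SettlingAlongCensoredKerrEnds) (hM : MGHDExists) : FinalStateConjecture := by
  -- D-0027 §2.1 deciding theorem, rev 5 (route-repair 2026-08-17, unused-crux). Binders: the glue item
  -- `TameEscapeGivenMassTheorems` (= `AdmissibleMassNonneg → ZeroMassAdmissibleMinkowskian → TameEscapeToKerrEnds`,
  -- the sorry-free deliverable of E's line once its gluing stub closes), the two promoted positive-mass cruxes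
  -- `AdmissibleMassNonneg` (#6) and `ZeroMassAdmissibleMinkowskian` (#7), and the cruxes `CensorshipAlongKerrEnds`,
  -- `SettlingAlongCensoredKerrEnds`, `MGHDExists`. The crux E = `TameEscapeToKerrEnds` is DERIVED on the first
  -- line; from there on the proof is the E-level assembly of rev 1–4 verbatim (two applications of the patching
  -- lemma `isTameChristodoulouGeneric_of_relative'` along tame curves + monotonicity for the anti-vacuity conjunct).
  have hE : TameEscapeToKerrEnds := hG hP hZ
  intro X _ _ _ _ _ _
  -- every admissible datum has a sole, strongly asymptotically flat end (so constant curves are tame)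
  have h𝓓 : ∀ d ∈ Literature.Geometry.Lorentzian.admissibleVacuumData X,
      ∃ e : Literature.Geometry.Lorentzian.AFEnd X, e.IsSoleEnd ∧
        ∃ M : ℝ, e.IsStronglyAsymptoticallyFlatDR d M := by
    intro d hd
    obtain ⟨e, M, hs, hM⟩ := hd.2
    exact ⟨e, hs, M, hM⟩
  -- step 1: Kerr-endedness is tame-generic (hE) and censorship is produced along Kerr-ended
  -- curves (hC); composition along curves gives: "Kerr-ended AND censored" is tame-generic
  have h1 : Literature.Geometry.Lorentzian.InitialDataSet.IsTameChristodoulouGeneric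
      (Literature.Geometry.Lorentzian.admissibleVacuumData X)
      (fun D ↦ (fun D ↦ ∀ [Literature.Geometry.Lorentzian.Kerr.Facts], ∃ (K : Set X) (U : Opens Literature.Geometry.Lorentzian.E3) (M a r₀ : ℝ) (hM : 0 ≤ M) (φ : U → X) (ψ : U → Literature.Geometry.Lorentzian.Kerr.region a r₀) (ν : Literature.Geometry.Lorentzian.NormalField 𝓘(ℝ, Literature.Geometry.Lorentzian.E4) ψ), IsCompact K ∧ Kᶜ ⊆ range φ ∧ Topology.IsOpenEmbedding φ ∧ ContMDiff 𝓘(ℝ, Literature.Geometry.Lorentzian.E3) (𝓡 3) ((⊤ : ℕ∞) : WithTop ℕ∞) φ ∧ Injective ψ ∧ (Literature.Geometry.Lorentzian.Kerr.smoothMetric M a r₀).IsSpacelikeImmersion 𝓘(ℝ, Literature.Geometry.Lorentzian.E3) ψ ∧ (Literature.Geometry.Lorentzian.Kerr.smoothMetric M a r₀).IsFutureUnitNormal 𝓘(ℝ, Literature.Geometry.Lorentzian.E3) ((Literature.Geometry.Lorentzian.Kerr.timeOrientation M a r₀ hM).ofLE le_top) ψ ν ∧ (∀ (y : U) (v w :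 Literature.Geometry.Lorentzian.E3), φ y ∉ K → D.h.inner (φ y) (mfderiv 𝓘(ℝ, Literature.Geometry.Lorentzian.E3) (𝓡 3) φ y v) (mfderiv 𝓘(ℝ, Literature.Geometry.Lorentzian.E3) (𝓡 3) φ y w) = Literature.Geometry.Lorentzian.Kerr.bilin M a (ψ y : Literature.Geometry.Lorentzian.E4) (mfderiv 𝓘(ℝ, Literature.Geometry.Lorentzian.E3) 𝓘(ℝ, Literature.Geometry.Lorentzian.E4) ψ y v) (mfderiv 𝓘(ℝ, Literature.Geometry.Lorentzian.E3) 𝓘(ℝ, Literature.Geometry.Lorentzian.E4) ψ y w)) ∧ (∀ [(Literature.Geometry.Lorentzian.Kerr.smoothMetric M a r₀).HasLeviCivita] (y : U) (v w : Literature.Geometry.Lorentzian.E3), φ y ∉ K → D.k (φ y) (mfderiv 𝓘(ℝ, Literature.Geometry.Lorentzian.E3) (𝓡 3) φ y v) (mfderiv 𝓘(ℝ, Literature.Geometry.Lorentzian.E3) (𝓡 3) φ y w) = (Literature.Geometry.Lorentzian.Kerr.smoothMetric M a r₀).secondFundamentalForm 𝓘(ℝ, Literature.Geometry.Lorentzian.E3)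 ψ ν y v w)) D ∧ (fun D ↦ ∀ 𝒟 : Literature.Geometry.Lorentzian.VacuumCauchyDevelopment D, 𝒟.IsMaximal → Summit.FinalStateConjecture.HasCompleteNullInfinity 𝒟.toCauchyDevelopment) D) 1 :=
    Literature.Geometry.Lorentzian.InitialDataSet.isTameChristodoulouGeneric_of_relative'
      h𝓓 (hE X) (hC X)
  -- step 2: completeness of 𝓘⁺ and settling of EVERY maximal development are produced along
  -- censored Kerr-ended curves (hS); composition along curves again
  have h2 : Literature.Geometry.Lorentzian.InitialDataSet.IsTameChristodoulouGeneric
      (Literature.Geometry.Lorentzian.admissibleVacuumData X)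
      (fun D ↦ ∀ 𝒟 : Literature.Geometry.Lorentzian.VacuumCauchyDevelopment D, 𝒟.IsMaximal → Summit.FinalStateConjecture.HasCompleteNullInfinity 𝒟.toCauchyDevelopment ∧ ∃ (O : Set 𝒟.carrier) (d : Literature.Geometry.Lorentzian.FinalStateDecomposition 𝒟.toSpacetime O 2), (∀ i, Literature.Geometry.Lorentzian.Kerr.IsSubextremal (d.mass i) (d.spin i)) ∧ O = Summit.FinalStateConjecture.exteriorOf 𝒟.toCauchyDevelopment d.charted ∧ Summit.FinalStateConjecture.RaysStayInClosure 𝒟.toCauchyDevelopment O ∧ Summit.FinalStateConjecture.HasExhaustiveCharts d ∧ Summit.FinalStateConjecture.IsFutureOriented d) 1 :=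
    Literature.Geometry.Lorentzian.InitialDataSet.isTameChristodoulouGeneric_of_relative'
      h𝓓 h1 (hS X)
  -- step 3: the anti-vacuity conjunct (an MGHD exists) holds pointwise on the admissible class (hM);
  -- tame genericity is monotone under pointwise implication
  exact h2.mono fun D hD hsettled ↦ ⟨hM X D hD, hsettled⟩

end Summit.FinalStateConjecture.FinalStateConjecture.Theses.ExactKerrEnds
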